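import Literature.NumberTheory.EllipticCurves.GreenbergSelmerNewform
import Literature.NumberTheory.EllipticCurves.HidaFamilyMembers
import Mathlib.NumberTheory.Padics.Complex
import HarnessLib

/-!
# The `p`-adic coefficient ring of an embedded newform and its integral Galois representation
# (definitions; vocabulary for Emerton–Pollack–Weston 2006 §3.1 and Wan 2015 Thm. 4)

Topic `Literature/NumberTheory/EllipticCurves`, namespace `Literature.NumberTheory.EllipticCurves`.

Emerton–Pollack–Weston, Invent. Math. 163 (2006) §3.1 (arXiv:math/0404484 p. 17), VERBATIM: "Let
`f = ∑ aₙqⁿ` be a `p`-ordinary and `p`-stabilized newform of weight `k ≥ 2`, tame level `N`, and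
character `χ`. Let `K` denote the finite extension of `ℚ_p` generated by the Fourier coefficients of
`f` and let `𝒪` denote the ring of integers of `K` … Let `ρ_f : G_ℚ → GL₂(K)` be the corresponding
Galois representation, characterized by the fact that the characteristic polynomial under `ρ_f` of
an arithmetic Frobenius at a prime `ℓ ∤ Np` is `X² − a_ℓ X + χ(ℓ)ℓ^{k−1}`. … It follows that, up to
conjugation by `GL₂(𝒪)`, there is a unique integral model `ρ_f : G_ℚ → GL₂(𝒪)`."

For a newform `g ∈ S_k(Γ₀(M))` (the tree's `CuspForm (Gamma0 M) k`, `IsNewform0`) with a ring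
embedding `ι : K_g → ℚ̄_p` of its coefficient field (`coeffField g →+* PadicAlgCl p`, as in the
tree's `hida_exists_congruent_ordinary_newform_of_multiplicative`) and the unit root `υ ∈ ℚ̄_p` of
`X² − ι(a_p)X + p^{k−1}` (the `U_p`-eigenvalue of the ordinary `p`-stabilisation), this file names:

* `padicCoeffField S = ℚ_p(S) ⊆ ℚ̄_p` (`IntermediateField.adjoin`) and its ring of integers
  `padicCoeffIntegers S = {x ∈ ℚ_p(S) : |x|_p ≤ 1}` as a subring of `ℚ̄_p` (closed under `+` by the
  ultrametric inequality), with the inclusion algebra structure; for the `p`-stabilised newform,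
  `S = memberGenerators g ι υ = ι(K_g) ∪ {υ}` gives EPW's `K` and `𝒪` (inside `ℚ̄_p`, with the
  `p`-adic topology);
* `IsIntegralPadicModel g ι υ ρ`: the framed representation `ρ : Γ_ℚ → GL₂(𝒪)`
  (`FramedGaloisRep ℚ (padicCoeffIntegers (memberGenerators g ι υ)) 2`) is unramified at every prime
  `ℓ ∤ Mp` with Frobenius characteristic polynomial `X² − ι(a_ℓ(g))X + ℓ^{k−1}` there (trivial
  character, weight `k`; arithmetic Frobenius, as in `IsGaloisRepOfNewform1Int`) — "an integral model
  of `ρ_{g,ι}`";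
* `IsOrdinaryMemberOf W p g ι`: `(g, ι)` is a good-ordinary weight-`k` member of the Hida family of
  `E[p]` in the form PRODUCED by `hida_exists_congruent_ordinary_newform_of_multiplicative` — `g` a
  newform of level `N/p`, `k > 2`, `k ≡ 2 (mod p−1)`, `|ι(a_p(g))|_p = 1`, `|ι(a_ℓ(g)) − a_ℓ(E)|_p < 1`
  for all primes `ℓ ∤ N` (EPW p. 2: "`H(ρ̄)` … the set of all `p`-ordinary `p`-stabilized newforms with
  mod `p` Galois representation isomorphic to `ρ̄`"; for `E[p]` irreducible the congruences give
  `ρ̄_{g,ι} ≅ E[p]` by Brauer–Nesbitt–Chebotarev).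

These are the binders of the cell `b2b-bsdres`'s GL₂ facts (Emerton–Pollack–Weston Thm. 1 / Thm.
5.1.3 and Wan Thm. 4 at a weight-`k` member; HOME/b2b-bsdres-x11a/GL2-VOCAB-SPEC.md), on top of the
Greenberg–Selmer vocabulary `GreenbergSelmerNewform.lean` (`Cofree ρ F`, `OrdinaryFiltration`,
`greenbergSelmer`, `DualData`, `charIdeal`). Definitions only (plus the inclusion ring map and its
algebra instance); nothing asserted.

References: Emerton–Pollack–Weston 2006, §3.1 (p. 17), p. 2; Deligne 1971 / Deligne–Serre 1974
Thm. 6.1 (existence of `ρ_f`); Wiles 1988 Thm. 2.2 (ordinarity).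
-/

noncomputable section

open scoped Classical MatrixGroups ModularForm

open NumberField IsDedekindDomain Field CongruenceSubgroup
open Literature.NumberTheory.GaloisRepresentations
open Literature.NumberTheory.EllipticCurves.ModularForms
open Rat.HeightOneSpectrum

namespace Literature.NumberTheory.EllipticCurves

variable {p : ℕ} [Fact p.Prime]

/-! ### The `p`-adic coefficient field `ℚ_p(S)` and its ring of integers inside `ℚ̄_p` -/

/-- The finite extension `K = ℚ_p(S) ⊆ ℚ̄_p` of `ℚ_p` generated by a set `S` (for a `p`-stabilised
newform: the embedded Fourier coefficients and the `U_p`-eigenvalue) — EPW §3.1 "`K` the finite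
extension of `ℚ_p` generated by the Fourier coefficients of `f`".
[cite: EmertonPollackWeston2006, §3.1 (arXiv:math/0404484 p. 17)] -/
abbrev padicCoeffField (S : Set (PadicAlgCl p)) : IntermediateField ℚ_[p] (PadicAlgCl p) :=
  IntermediateField.adjoin ℚ_[p] S

/-- The ring of integers `𝒪 = {x ∈ ℚ_p(S) : |x|_p ≤ 1}` of `ℚ_p(S)`, as a subring of `ℚ̄_p` (closed
under addition by the ultrametric inequality) — EPW §3.1 "`𝒪` the ring of integers of `K`"; it
carries the subspace (`p`-adic) topology. [cite: EmertonPollackWeston2006, §3.1 (arXiv:math/0404484 p. 17)] -/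
def padicCoeffIntegers (S : Set (PadicAlgCl p)) : Subring (PadicAlgCl p) where
  carrier := {x | x ∈ padicCoeffField S ∧ ‖x‖ ≤ 1}
  mul_mem' := fun {a b} ha hb =>
    ⟨mul_mem ha.1 hb.1, by rw [norm_mul]; exact mul_le_one₀ ha.2 (norm_nonneg _) hb.2⟩
  one_mem' := ⟨one_mem _, by rw [norm_one]⟩
  add_mem' := fun {a b} ha hb =>
    ⟨add_mem ha.1 hb.1, (IsUltrametricDist.norm_add_le_max a b).trans (max_le ha.2 hb.2)⟩
  zero_mem' := ⟨zero_mem _, by rw [norm_zero]; exact zero_le_one⟩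
  neg_mem' := fun {a} ha => ⟨neg_mem ha.1, by rw [norm_neg]; exact ha.2⟩

/-- Membership in `𝒪`. [cite: EmertonPollackWeston2006, §3.1 (arXiv:math/0404484 p. 17)] -/
theorem mem_padicCoeffIntegers_iff (S : Set (PadicAlgCl p)) (x : PadicAlgCl p) :
    x ∈ padicCoeffIntegers S ↔ x ∈ padicCoeffField S ∧ ‖x‖ ≤ 1 :=
  Iff.rfl

/-- The inclusion `𝒪 ↪ K = ℚ_p(S)` as a ring map. [cite: EmertonPollackWeston2006, §3.1 (arXiv:math/0404484 p. 17)] -/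
def padicCoeffIntegers.toField (S : Set (PadicAlgCl p)) :
    padicCoeffIntegers S →+* padicCoeffField S where
  toFun x := ⟨x.1, x.2.1⟩
  map_one' := rfl
  map_mul' _ _ := rfl
  map_zero' := rfl
  map_add' _ _ := rfl

/-- `K = ℚ_p(S)` as an `𝒪`-algebra through the inclusion (so that `GreenbergSelmer.Cofree ρ K = K²/𝒪²`
is EPW's cofree module `A_f`). [folklore] -/
instance padicCoeffIntegers.algebraField (S : Set (PadicAlgCl p)) :
    Algebra (padicCoeffIntegers S) (padicCoeffField S) :=
  (padicCoeffIntegers.toField S).toAlgebra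

/-! ### The embedded newform: generators, integral model, membership in `H(E[p])` -/

section Newform

variable {M : ℕ} {k : ℤ}

/-- The generating set `ι(K_g) ∪ {υ}` of the `p`-adic coefficient field of the `p`-stabilisation of
`g` along `ι` (`υ` the `U_p`-eigenvalue): EPW §3.1 "generated by the Fourier coefficients of `f`",
`f` the `p`-stabilised newform. [cite: EmertonPollackWeston2006, §3.1 (arXiv:math/0404484 p. 17)] -/
def memberGenerators (g : CuspForm (Gamma0 M) k) (ι : coeffField g →+* PadicAlgCl p)
    (υ : PadicAlgCl p) : Set (PadicAlgCl p) :=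
  Set.range ι ∪ {υ}

/-- **`IsIntegralPadicModel g ι υ ρ`: `ρ : Γ_ℚ → GL₂(𝒪)` is an integral `p`-adic model of the Galois
representation of the newform `g ∈ S_k(Γ₀(M))` along `ι`** (`𝒪` the integers of
`ℚ_p(ι K_g, υ) ⊆ ℚ̄_p`): for every prime `ℓ ∤ Mp`, `ρ` is unramified at `ℓ` and every arithmetic
Frobenius at `ℓ` has characteristic polynomial `X² − ι(a_ℓ(g))X + ℓ^{k−1}` (trivial character) —
EPW §3.1 "characterized by the fact that the characteristic polynomial under `ρ_f` of an arithmetic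
Frobenius at a prime `ℓ ∤ Np` is `X² − a_ℓX + χ(ℓ)ℓ^{k−1}` … a unique integral model
`ρ_f : G_ℚ → GL₂(𝒪)`" (Deligne). The polynomial is required to have coefficients in `𝒪` (as in the
tree's `IsGaloisRepOfNewform1Int`). A predicate; existence (Deligne 1971, Deligne–Serre 1974
Thm. 6.1, plus a stable lattice) is not asserted here.
[cite: EmertonPollackWeston2006, §3.1 (arXiv:math/0404484 p. 17)] [cite: DeligneSerreASENS1974, Thm. 6.1, (6.1.1)] -/
def IsIntegralPadicModel (g : CuspForm (Gamma0 M) k) (ι : coeffField g →+* PadicAlgCl p)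
    (υ : PadicAlgCl p) (ρ : FramedGaloisRep ℚ (padicCoeffIntegers (memberGenerators g ι υ)) 2) :
    Prop :=
  ∀ v : HeightOneSpectrum (𝓞 ℚ), ¬ ((primesEquiv v : Nat.Primes) : ℕ) ∣ M * p →
    ρ.IsUnramifiedAt v ∧
      ∃ P : Polynomial (padicCoeffIntegers (memberGenerators g ι υ)),
        P.map (padicCoeffIntegers (memberGenerators g ι υ)).subtype =
            Polynomial.X ^ 2
              - Polynomial.C (ι ⟨(UpperHalfPlane.qExpansion 1 ⇑g).coeff ((primesEquiv v : Nat.Primes) : ℕ),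
                  coeff_mem_coeffField g _⟩) * Polynomial.X
              + Polynomial.C ((((primesEquiv v : Nat.Primes) : ℕ) : PadicAlgCl p) ^ (k - 1).toNat) ∧
          ρ.HasFrobCharpolyAt v P

end Newform

/-- **`IsOrdinaryMemberOf W p g ι`: `(g, ι)` is a good-ordinary weight-`k` classical member of the
Hida family `H(E[p])` of the elliptic curve `E = W` at the multiplicative prime `p`, in the form
produced by `hida_exists_congruent_ordinary_newform_of_multiplicative`**: `g ∈ S_k(Γ₀(N/p))` a
newform, `k > 2`, `k ≡ 2 (mod p − 1)`, `|ι(a_p(g))|_p = 1` (ordinary along `ι`), and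
`|ι(a_ℓ(g)) − a_ℓ(E)|_p < 1` for every prime `ℓ ∤ N` (congruent to `f_E` modulo the prime of `ι`;
for `E[p]` irreducible, `ρ̄_{g,ι} ≅ E[p]` by Brauer–Nesbitt and Chebotarev, i.e. `g ∈ H(E[p])` in the
sense of EPW p. 2). A predicate; nothing asserted.
[cite: EmertonPollackWeston2006, Intro p. 2 (H(ρ̄)), Thm. 2.1.2 and §2.1 (p. 7), Ex. 5.3.1 (p. 32)] -/
def IsOrdinaryMemberOf (W : WeierstrassCurve ℚ) [W.IsElliptic] [W.IsGloballyMinimal] (p : ℕ)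
    [Fact p.Prime] [NeZero (W.conductorNorm ℤ / p)] {k : ℤ}
    (g : CuspForm (Gamma0 (W.conductorNorm ℤ / p)) k) (ι : coeffField g →+* PadicAlgCl p) : Prop :=
  2 < k ∧ ((p : ℤ) - 1) ∣ (k - 2) ∧ IsNewform0 g ∧
    ‖ι ⟨(UpperHalfPlane.qExpansion 1 ⇑g).coeff p, coeff_mem_coeffField g p⟩‖ = 1 ∧
    ∀ ℓ : ℕ, ℓ.Prime → ¬ ℓ ∣ W.conductorNorm ℤ →
      ‖ι ⟨(UpperHalfPlane.qExpansion 1 ⇑g).coeff ℓ, coeff_mem_coeffField g ℓ⟩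
          - ((W.frobeniusTrace ℓ : ℤ) : PadicAlgCl p)‖ < 1

/-! ### Ordinary `p`-adic data of an embedded newform (the binders of EPW §3.1, bundled) -/

section Data

variable {M : ℕ} {k : ℤ}

/-- **Ordinary `p`-adic data of the newform `g` along `ι`** — the objects Emerton–Pollack–Weston
§3.1 attach to a `p`-ordinary `p`-stabilised newform, bundled as DATA (nothing asserted about their
existence): the unit root `υ` of `X² − ι(a_p(g))X + p^{k−1}` (`|υ|_p = 1`; the `U_p`-eigenvalue of
the ordinary `p`-stabilisation), an integral model `ρ : Γ_ℚ → GL₂(𝒪)` over the integers `𝒪` of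
`ℚ_p(ι K_g, υ)` (`IsIntegralPadicModel`; Deligne), and an ordinary filtration of `ρ` at the place(s)
above `p` (`GreenbergSelmer.OrdinaryFiltration`: a `D_p`-stable rank-one direct summand with
unramified quotient — EPW (eq:ordes), Wiles 1988 Thm. 2.2). Existence of such data for an
`ι`-ordinary newform (Deligne + Wiles) is NOT asserted here.
[cite: EmertonPollackWeston2006, §3.1 (arXiv:math/0404484 p. 17), (eq:ordes)] [cite: Wiles1988, Thm. 2.2] -/
structure OrdinaryPadicData (g : CuspForm (Gamma0 M) k) (p : ℕ) [Fact p.Prime]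
    (ι : coeffField g →+* PadicAlgCl p) where
  /-- the unit root `υ` of the `p`-Hecke polynomial along `ι` -/
  υ : PadicAlgCl p
  /-- `υ² − ι(a_p)υ + p^{k−1} = 0` -/
  υ_root : υ ^ 2 - ι ⟨(UpperHalfPlane.qExpansion 1 ⇑g).coeff p, coeff_mem_coeffField g p⟩ * υ
      + (p : PadicAlgCl p) ^ (k - 1).toNat = 0
  /-- `|υ|_p = 1` -/
  norm_υ : ‖υ‖ = 1
  /-- an integral model `ρ : Γ_ℚ → GL₂(𝒪)`, `𝒪` the integers of `ℚ_p(ι K_g, υ)` -/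
  ρ : FramedGaloisRep ℚ (padicCoeffIntegers (memberGenerators g ι υ)) 2
  /-- `ρ` is an integral `p`-adic model of `ρ_{g,ι}` -/
  isModel : IsIntegralPadicModel g ι υ ρ
  /-- the ordinary filtration(s) at the place(s) above `p` -/
  fil : ∀ v : HeightOneSpectrum (𝓞 ℚ), ((p : ℕ) : 𝓞 ℚ) ∈ v.asIdeal →
    GreenbergSelmer.OrdinaryFiltration ρ v

namespace OrdinaryPadicData

variable {g : CuspForm (Gamma0 M) k} {ι : coeffField g →+* PadicAlgCl p}

/-- The plus-parts of the data (forgetting rank one / unramified quotient), as consumed by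
`GreenbergSelmer.greenbergSelmer` / `DualData`. [cite: EmertonPollackWeston2006, §3.1 (eq:ordes)] -/
def plus (𝔇 : OrdinaryPadicData g p ι) :
    ∀ v : HeightOneSpectrum (𝓞 ℚ), ((p : ℕ) : 𝓞 ℚ) ∈ v.asIdeal → GreenbergSelmer.PlusPart 𝔇.ρ v :=
  fun v hv => (𝔇.fil v hv).toPlusPart

end OrdinaryPadicData

end Data


/-! ### Members of `H(E[p])` of ANY tame level prime to `p` (sized ask S-g19-1 of the X11a seat,
2026-08-21; literature seat gen 40)

EPW p. 2 (arXiv:math/0404484), VERBATIM: "The Hida family `H(ρ̄)` of `ρ̄` is the set of all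
`p`-ordinary `p`-stabilized newforms `f` with mod `p` Galois representation isomorphic to `ρ̄`."
— ALL tame levels: Thm. 2 (p. 2) compares `λ`-invariants of two members `f₁, f₂ ∈ H(ρ̄)` "on the
branches `T(𝔞₁), T(𝔞₂)`" through "the sum … over all primes dividing the tame level of `f₁` or
`f₂`", and §2.3 (p. 14) builds "the Hida family attached to `ρ̄`" as the ind-scheme over all finite
sets `Σ`, i.e. over all tame levels `N(Σ)`. The tree's `IsOrdinaryMemberOf` fixes the level `N/p`
only because its first producer (`hida_exists_congruent_ordinary_newform_of_multiplicative`, Hida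
1986) delivers that level; the modularity-based producer
`exists_isNewform0_dvd_conductorNorm_div_congr_of_multiplicative_of_exists_isNewformOf`
(`HidaFamilyMembersMultiplicativeProofs.lean`) delivers a member of SOME level `M′ ∣ N/p`. The
predicate below frees the level; at `M = N/p` it is the old one
(`isOrdinaryMemberOfLevel_iff_isOrdinaryMemberOf`). -/

/-- **`IsOrdinaryMemberOfLevel W p g ι`: `(g, ι)` is a good-ordinary weight-`k` classical member of
the Hida family `H(E[p])` of the elliptic curve `E = W`, of tame level `M` (ANY `M`; the consumer
facts add `p ∤ M`)**: `g ∈ S_k(Γ₀(M))` a newform, `k > 2`, `k ≡ 2 (mod p − 1)`, `|ι(a_p(g))|_p = 1`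
(ordinary along `ι`), and `|ι(a_ℓ(g)) − a_ℓ(E)|_p < 1` for every prime `ℓ ∤ N·M` (congruent to
`f_E` modulo the prime of `ι` at every prime of good reduction for `E` not dividing the level of
`g`; for `E[p]` irreducible, `ρ̄_{g,ι} ≅ E[p]` by Brauer–Nesbitt and Chebotarev, i.e. `g ∈ H(E[p])`
in the sense of EPW p. 2: "the set of all `p`-ordinary `p`-stabilized newforms `f` with mod `p`
Galois representation isomorphic to `ρ̄`" — members of every tame level). Level-generic twin of
`IsOrdinaryMemberOf` (= this predicate at `M = N/p`, see
`isOrdinaryMemberOfLevel_iff_isOrdinaryMemberOf`). A predicate; nothing asserted.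
[cite: EmertonPollackWeston2006, Intro p. 2 (H(ρ̄)) and Thm. 2 (arXiv:math/0404484 p. 2), §2.3 (p. 14), Ex. 5.3.1 (p. 32)] -/
def IsOrdinaryMemberOfLevel (W : WeierstrassCurve ℚ) [W.IsElliptic] [W.IsGloballyMinimal] (p : ℕ)
    [Fact p.Prime] {M : ℕ} [NeZero M] {k : ℤ}
    (g : CuspForm (Gamma0 M) k) (ι : coeffField g →+* PadicAlgCl p) : Prop :=
  2 < k ∧ ((p : ℤ) - 1) ∣ (k - 2) ∧ IsNewform0 g ∧
    ‖ι ⟨(UpperHalfPlane.qExpansion 1 ⇑g).coeff p, coeff_mem_coeffField g p⟩‖ = 1 ∧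
    ∀ ℓ : ℕ, ℓ.Prime → ¬ ℓ ∣ W.conductorNorm ℤ * M →
      ‖ι ⟨(UpperHalfPlane.qExpansion 1 ⇑g).coeff ℓ, coeff_mem_coeffField g ℓ⟩
          - ((W.frobeniusTrace ℓ : ℤ) : PadicAlgCl p)‖ < 1

section MemberOfLevel

variable {W : WeierstrassCurve ℚ} [W.IsElliptic] [W.IsGloballyMinimal] {p : ℕ} [Fact p.Prime]

/-- A level-`N/p` member (`IsOrdinaryMemberOf`) is a member of level `M = N/p` in the level-generic
sense: the congruences at every `ℓ ∤ N` include those at every `ℓ ∤ N·(N/p)`. (Unconditional; this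
is the direction the old level-`N/p` facts need in order to follow from their level-generic
twins.) [cite: EmertonPollackWeston2006, Intro p. 2 (H(ρ̄): members of every tame level) (arXiv:math/0404484 p. 2)] -/
theorem IsOrdinaryMemberOf.ofLevel [NeZero (W.conductorNorm ℤ / p)] {k : ℤ}
    {g : CuspForm (Gamma0 (W.conductorNorm ℤ / p)) k} {ι : coeffField g →+* PadicAlgCl p}
    (h : IsOrdinaryMemberOf W p g ι) : IsOrdinaryMemberOfLevel W p g ι := by
  refine ⟨h.1, h.2.1, h.2.2.1, h.2.2.2.1, fun ℓ hℓ hℓN => h.2.2.2.2 ℓ hℓ ?_⟩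
  exact fun hdvd => hℓN (dvd_mul_of_dvd_left hdvd _)

/-- At `M = N/p` with `p ∣ N` (e.g. `p` multiplicative) the level-generic member predicate IS the
old one: for a prime `ℓ`, `ℓ ∣ N·(N/p) ↔ ℓ ∣ N` because `N = p·(N/p)`.
[cite: EmertonPollackWeston2006, Intro p. 2 (H(ρ̄)) (arXiv:math/0404484 p. 2)] -/
theorem isOrdinaryMemberOfLevel_iff_isOrdinaryMemberOf [NeZero (W.conductorNorm ℤ / p)] {k : ℤ}
    {g : CuspForm (Gamma0 (W.conductorNorm ℤ / p)) k} {ι : coeffField g →+* PadicAlgCl p}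
    (hpN : p ∣ W.conductorNorm ℤ) :
    IsOrdinaryMemberOfLevel W p g ι ↔ IsOrdinaryMemberOf W p g ι := by
  refine ⟨fun h => ⟨h.1, h.2.1, h.2.2.1, h.2.2.2.1, fun ℓ hℓ hℓN => h.2.2.2.2 ℓ hℓ ?_⟩,
    IsOrdinaryMemberOf.ofLevel⟩
  intro hdvd
  rcases (Nat.Prime.dvd_mul hℓ).mp hdvd with h1 | h2
  · exact hℓN h1
  · exact hℓN (h2.trans (Nat.div_dvd_of_dvd hpN))

/-- Unfolding of the level-generic member predicate.
[cite: EmertonPollackWeston2006, Intro p. 2 (H(ρ̄)) (arXiv:math/0404484 p. 2)] -/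
theorem isOrdinaryMemberOfLevel_iff {M : ℕ} [NeZero M] {k : ℤ} {g : CuspForm (Gamma0 M) k}
    {ι : coeffField g →+* PadicAlgCl p} :
    IsOrdinaryMemberOfLevel W p g ι ↔
      2 < k ∧ ((p : ℤ) - 1) ∣ (k - 2) ∧ IsNewform0 g ∧
        ‖ι ⟨(UpperHalfPlane.qExpansion 1 ⇑g).coeff p, coeff_mem_coeffField g p⟩‖ = 1 ∧
        ∀ ℓ : ℕ, ℓ.Prime → ¬ ℓ ∣ W.conductorNorm ℤ * M →
          ‖ι ⟨(UpperHalfPlane.qExpansion 1 ⇑g).coeff ℓ, coeff_mem_coeffField g ℓ⟩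
              - ((W.frobeniusTrace ℓ : ℤ) : PadicAlgCl p)‖ < 1 :=
  Iff.rfl

end MemberOfLevel

end Literature.NumberTheory.EllipticCurves

end
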